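import Summits.KontsevichZagierPeriods.KontsevichZagierPeriods.Theorems.SoloBlindReduction
import Summits.KontsevichZagierPeriods.KontsevichZagierPeriods.Theorems.SoloBlindInjective
import HarnessLib

/-!
# The Kontsevich–Zagier conjecture in dimension `≤ 1`

`kz_dim_le_one`: two RATIONAL integral representations of dimension `≤ 1` (rational integrands
on `ℚ`-semialgebraic subsets of `ℝ⁰` or `ℝ¹`, absolutely convergent) with the same value are
equivalent under the Kontsevich–Zagier moves (`KZ.relations`: additivity, algebraic change of
variables, Newton–Leibniz).  This is the conjunct `n, m ≤ 1` of
`Literature.Periods.KZPeriodConjecture` restricted to rational data, proved unconditionally.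

Proof.  NORMAL FORM (`isCellSum_of_isRational_one`, parts I–VII): every such representation is
congruent to a cell sum `K(α) + Σ L(cᵢ; λᵢ) + Σ A(dₖ; τₖ)` (`λᵢ > 1`, `τₖ > 0`, real algebraic
data).  INJECTIVITY (`cells_injective`, parts II–III): a cell sum of value `0` is a relation, by
Baker's theorem in decomposition form and the peeling moves.  Since relations have value `0`
(`KZ.relations_le_ker_eval_holds`), the difference of two representations with equal values is a
cell sum of value `0`, hence a relation.
-/

noncomputable section

open MeasureTheory Set Filter
open scoped BigOperators Topology
open Literature.NumberTheory.Transcendental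
open Literature.NumberTheory.Transcendental.KZ
open Literature.ModelTheory.ExponentialFields (IsSemialgebraic)

namespace Summit.KontsevichZagierPeriods.KontsevichZagierPeriods.Theorems

namespace SoloBlind

/-- The value of a standard cell sum. -/
theorem eval_cellSum {ιL ιA : Type} [Fintype ιL] [Fintype ιA] (α : ℝ) (hα : IsAlgebraic ℚ α)
    (c l : ιL → ℝ) (hc : ∀ i, IsAlgebraic ℚ (c i)) (hl : ∀ i, IsAlgebraic ℚ (l i))
    (d τ : ιA → ℝ) (hd : ∀ k, IsAlgebraic ℚ (d k)) (hτ : ∀ k, IsAlgebraic ℚ (τ k))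
    (h1 : ∀ i, 1 < l i) (h0 : ∀ k, 0 < τ k) :
    eval (cellSum α hα c l hc hl d τ hd hτ) =
      α + ∑ i, c i * Real.log (l i) + ∑ k, d k * Real.arctan (τ k) := by
  simp only [cellSum, map_add, map_sum, eval_of, value_constCell]
  congr 1
  · congr 1
    exact Finset.sum_congr rfl fun i _ => value_logCell (h1 i).le
  · exact Finset.sum_congr rfl fun k _ => value_atanCell (h0 k).le

/-- **Injectivity on the cell class.** A cell sum of value `0` is a relation. -/
theorem mem_relations_of_isCellSum_of_eval_eq_zero {z : FormalRep} (hz : IsCellSum z)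
    (h : eval z = 0) : z ∈ relations := by
  obtain ⟨ιL, ιA, _, _, α, hα, c, l, hc, hl, d, τ, hd, hτ, h1, h0, hrel⟩ := hz
  have hval : α + ∑ i, c i * Real.log (l i) + ∑ k, d k * Real.arctan (τ k) = 0 := by
    rw [← eval_cellSum α hα c l hc hl d τ hd hτ h1 h0]
    have h' : eval (z - cellSum α hα c l hc hl d τ hd hτ) = 0 :=
      (AddMonoidHom.mem_ker).1 ((show relations ≤ eval.ker from KZ.relations_le_ker_eval_holds) hrel)
    rw [map_sub, h, zero_sub, neg_eq_zero] at h'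
    exact h'
  have hcells : cellSum α hα c l hc hl d τ hd hτ ∈ relations :=
    cells_injective hα c l hc hl h1 d τ hd hτ h0 hval
  simpa using add_mem hrel hcells

/-- Every rational representation of dimension `≤ 1` is a cell sum. -/
theorem isCellSum_of_isRational_of_le_one {n : ℕ} (r : IntegralRep n) (hn : n ≤ 1)
    (hr : r.IsRational) : IsCellSum (of r) := by
  interval_cases n
  · obtain ⟨q, hq, -⟩ := exists_constCell_of_dim_zero r hr
    exact (isCellSum_constCell _ _).of_sub_mem hq
  · exact isCellSum_of_isRational_one r hr

/-- **The Kontsevich–Zagier period conjecture in dimension `≤ 1` (rational form).**  Two rational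
integral representations of dimension `≤ 1` with equal values are equivalent under the
Kontsevich–Zagier moves. -/
theorem kz_dim_le_one {n m : ℕ} (r : IntegralRep n) (r' : IntegralRep m) (hn : n ≤ 1) (hm : m ≤ 1)
    (hr : r.IsRational) (hr' : r'.IsRational) (h : r.value = r'.value) : Equivalent r r' := by
  have hz : IsCellSum (of r - of r') :=
    (isCellSum_of_isRational_of_le_one r hn hr).sub (isCellSum_of_isRational_of_le_one r' hm hr')
  exact mem_relations_of_isCellSum_of_eval_eq_zero hz (by rw [map_sub, eval_of, eval_of, h, sub_self])

/-- `kz_dim_le_one` is exactly the conjunct `n, m ≤ 1` of the statement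
`Literature.Periods.KZPeriodConjecture` (whose hypotheses are rationality and equality of
values). -/
theorem kzPeriodConjecture_dim_le_one :
    ∀ ⦃n m : ℕ⦄ (r : IntegralRep n) (r' : IntegralRep m), n ≤ 1 → m ≤ 1 →
      r.IsRational → r'.IsRational → r.value = r'.value → Equivalent r r' :=
  fun _ _ r r' hn hm hr hr' h => kz_dim_le_one r r' hn hm hr hr' h

end SoloBlind

end Summit.KontsevichZagierPeriods.KontsevichZagierPeriods.Theorems
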